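import Literature.Geometry.Kaehler.ComplexTorusInvertibleIdealQuotients
import Literature.NumberTheory.ComplexMultiplication.CMTorusIdealMultiplications
import Literature.NumberTheory.ComplexMultiplication.CMTorusHomOfPrimitiveType
import HarnessLib

/-!
# Shimura's `𝔠`-multiplications of the principal CM tori are Kieffer's ideal isogenies `φ_I`:
# `𝔤(𝔠, A) = H(End(A)ι(𝔠))`, `End(A)ι(𝔠)` is an invertible kernel ideal, and the `𝔠`-transform is
# `A/H(End(A)ι(𝔠))` (junction of Shimura 1998 §7.1–7.4 with Kieffer 2024 §1.4 — torus level)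

Two series of the tree describe "isogenies from ideals" for a complex torus:

* `NumberTheory/ComplexMultiplication/CMTorusIdealMultiplications` (Shimura 1998 §7): for the principal CM
  tori `A = X_𝔞 = ℂ^Φ/D(𝔞) = ComplexTorus (periodIso Φ I)` of a CM type `Φ` of a number field `K`, with
  `ι(a) = mapMatrix (mulMatrix I a)` (`a ∈ 𝓞_K`), the groups `𝔤(𝔠, A) = {t : ι(a)t = 0 ∀ a ∈ 𝔠}`
  (`idealTorsion`) of an integral ideal `𝔠`, and the `𝔠`-multiplication `λ_𝔠 : X_𝔞 → X_{𝔠⁻¹𝔞}` onto the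
  `𝔠`-transform (`inclusionHom`, `transformIdeal`; "**PROPOSITION 8.** … the kernel of `λ` is `𝔤(𝔞, A)`",
  `ker_inclusionHom_transformIdeal`);
* `Geometry/Kaehler/ComplexTorusKernelIdeals` … `ComplexTorusInvertibleIdealQuotients` (Kieffer 2024 §1.4,
  after Waterhouse 1969): for ANY complex torus `X` and a left ideal `I ⊆ End(X) = endRingInt`, the subgroup
  `H(I) = ⋂_{α ∈ I} ker α` (`kernelSubgroup`), the quotient `φ_I : X → X/H(I)` (`quotientByPeriod`), kernel
  ideals and invertible ideals ("Let `I` be an invertible ideal in `R`. By Proposition 1.4.7, the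
  endomorphism ring of `A/H(I)` is still `R`; by Proposition 1.4.6, `A/H(I)` (up to isomorphism) does not
  depend on the class of `I` in the class group, and `A/H(I) ≃ A` if and only if `I` lies in the trivial
  class" [Kieffer2024IsogenyGraphs, §1.4.3, p. 47]).

This file proves that on the principal CM tori the two coincide:

> Shimura, §7.1 (p. 50): "we denote by `𝔤(𝔞, A)` […] the set of points `t` on `A` such that `ι(α)t = 0`
> for every `α ∈ 𝔞`. **PROPOSITION 8.** […] the kernel of `λ` is `𝔤(𝔞, A)`."  §7.3 (p. 57): "`(A_c, ι_c)`
> and `(A_d, ι_d)` are isomorphic if and only if `c = d`."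
> Kieffer, §1.4.1 Def. 1.4.1 (p. 43): "`H(I) = ⋂_{α ∈ I} ker(α)` […] `φ_I : A → A/H(I)`"; "if `I` is a
> principal ideal of the form `End(A)α`, then `H(I) = ker(α)` and `φ_I = α`."

**Results.** For the left ideal `I_𝔠 = End(X_𝔞)·ι(𝔠)` generated by `ι(𝔠)` (`iotaIdeal Φ I 𝔠`):
(1) `H(I_𝔠) = 𝔤(𝔠, A)` (`kernelSubgroup_iotaIdeal` — both are `⋂_{a ∈ 𝔠} ker ι(a)`);
(2) `X_𝔞/H(I_𝔠) ≅ X_{𝔠⁻¹𝔞}`, Kieffer's `φ_{I_𝔠}` and Shimura's `λ_𝔠` being isogenies out of `X_𝔞` with the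
same kernel (`isIsomorphic_quotient_iotaIdeal_transformIdeal`, by Prop. 1.1.11 =
`IsIsogeny.isIsomorphic_of_ker_eq`);
(3) `I_𝔠` is an INVERTIBLE ideal of `End(X_𝔞)` for every CM type (`isInvertibleIdeal_iotaIdeal`: with
`Σ_k γ_k c_k = 1`, `γ_k ∈ 𝔠⁻¹`, `c_k ∈ 𝔠`, take `x_k = ι_ℚ(γ_k) ∈ End⁰(X_𝔞)` and `σ_k = ι(c_k)`; then
`I_𝔠 x_k ⊆ End(X_𝔞)` because `ι(c)ι_ℚ(γ) = ι(cγ)` with `cγ ∈ 𝔠𝔠⁻¹ = 𝓞_K`), hence a KERNEL ideal: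
`{α ∈ End(X_𝔞) : α 𝔤(𝔠, A) = 0} = End(X_𝔞)·ι(𝔠)` (`idealOfSubgroup_idealTorsion`), and `𝔤(𝔠, A)` is finite
with `X_𝔞/𝔤(𝔠, A) ≅ X_𝔞 ⟺ I_𝔠 = End(X_𝔞)α` for an isogeny `α` (Kieffer's trivial-class criterion);
(4) for a PRIMITIVE CM type (`End(X_𝔞) = ι(𝓞_K)`, `endRingEquivOfPrimitive`), `I_𝔠 = ι(𝔠)` under
`𝓞_K ≅ End(X_𝔞)` (`iotaIdeal_eq_map_of_primitive`) and Kieffer's criterion becomes Shimura's §7.3: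
**`X_{𝔠⁻¹𝔞} ≅ X_𝔞` as complex tori iff `𝔠` is principal** (`isIsomorphic_transformIdeal_iff_isPrincipal_of_primitive`;
the tree's `isCMTorusIsomorphic_transformIdeal_iff` is the `ι`-equivariant version for every `Φ`).

## Contents (namespace `Literature.NumberTheory.ComplexMultiplication.CMTypeLattice`)

* §1 `iotaIdeal`, `mulMatrix_mem_iotaIdeal`, **`kernelSubgroup_iotaIdeal`**, `finite_kernelSubgroup_iotaIdeal`,
  **`isIsomorphic_quotient_iotaIdeal_transformIdeal`**.
* §2 `exists_sum_mul_eq_one_of_ne_bot` (`1 = Σ γ_k c_k`), **`isInvertibleIdeal_iotaIdeal`**,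
  `isKernelIdeal_iotaIdeal`, **`idealOfSubgroup_idealTorsion`**, `isIsomorphic_quotient_idealTorsion_self_iff`.
* §3 (primitive types) `iotaIdeal_eq_map_of_primitive`, **`isIsomorphic_transformIdeal_iff_isPrincipal_of_primitive`**.
* §4 (add-only sequel) Kieffer's THEOREM 1.4.9 ("assume that `End(A)` is a maximal order. Then every ideal `I`
  of `End(A)` is a kernel ideal, the degree of `φ_I` equals the reduced norm of `I`, and the endomorphism ring
  of `A/H(I)` is also maximal" [Kieffer2024IsogenyGraphs, §1.4.2, p. 46]) for the principal CM tori of a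
  PRIMITIVE type (`End(X_𝔞) = ι(𝓞_K)` maximal and commutative, reduced norm = `N`):
  `natCard_kernelSubgroup_iotaIdeal` (`deg φ_{I_𝔠} = #𝔤(𝔠, A) = N(𝔠)`, every `Φ`), `iotaIdeal_bot`,
  `isKernelIdeal_bot`, `eq_iotaIdeal_comap_of_primitive`, **`isKernelIdeal_of_primitive`** (every ideal of
  `End(X_𝔞)` is a kernel ideal), `endAlgRat_comm_of_primitive`,
  **`quotientEndEquivRingOfIntegersOfPrimitive`** (`End(X_𝔞/H(I_𝔠)) ≅ 𝓞_K`, "also maximal"),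
  `map_mulMatrix_quotientEndEquivRingOfIntegersOfPrimitive`.

No named facts are introduced (two definitions with bodies and proved theorems only).

## References

* [Shimura1998] G. Shimura, *Abelian Varieties with Complex Multiplication and Modular Functions*, Princeton
  1998, §7.1 Props. 7–8 (pp. 49–50), §7.3 (p. 57), §7.4 Prop. 15 (p. 58); §14.1 Prop. 1 (p. 101).
* [Kieffer2024IsogenyGraphs] J. Kieffer, *Isogeny graphs in higher dimensions* (2024), §1.4.1 Def. 1.4.1–1.4.2
  and Prop. 1.1.11 (pp. 10, 43), §1.4.2 Thm. 1.4.9 (p. 46, after [Wat69, Thm. 3.15]), §1.4.3 sketch of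
  proof of Theorem 2 (p. 47).
-/

noncomputable section

open scoped Classical nonZeroDivisors NumberField Manifold ContDiff
open NumberField Module FractionalIdeal

namespace Literature.NumberTheory.ComplexMultiplication

open Literature.AlgebraicGeometry.Motives (CMType)
open Literature.Geometry.Kaehler
open Literature.Geometry.Kaehler.ComplexTorus

namespace CMTypeLattice

variable {K : Type} [Field K] [NumberField K]
variable (Φ : CMType K) (I : (FractionalIdeal (𝓞 K)⁰ K)ˣ)

/-- Entrywise cast `ℤ → ℚ` of a product of square matrices. [folklore] -/
private theorem map_intCast_mul_aux6 {n : Type*} [Fintype n] (A B : Matrix n n ℤ) :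
    (A * B).map (Int.cast : ℤ → ℚ) = A.map (Int.cast : ℤ → ℚ) * B.map (Int.cast : ℤ → ℚ) :=
  Matrix.map_mul (f := Int.castRingHom ℚ)

/-! ## §1 The ideal `End(X_𝔞)·ι(𝔠)`, its kernel subgroup `𝔤(𝔠, A)` and its quotient -/

section IotaIdeal

/-- **`I_𝔠 = End(X_𝔞)·ι(𝔠)`**: the left ideal of `End(X_𝔞) = endRingInt (periodIso Φ I)` generated by the
endomorphisms `ι(a) = mulMatrix I a`, `a ∈ 𝔠` (Kieffer's "ideal in `End(A)`" attached to Shimura's integral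
ideal `𝔠 ⊆ 𝓞_K`). [cite: Kieffer2024IsogenyGraphs, §1.4.1 Def. 1.4.1, p. 43] [cite: Shimura1998, §7.1 (before Prop. 8), p. 50] -/
def iotaIdeal (𝔠 : Ideal (𝓞 K)) : Ideal (endRingInt (periodIso Φ I)) :=
  Ideal.span (Set.range fun a : 𝔠 ↦ (⟨mulMatrix I (a : 𝓞 K), mulMatrix_mem_endRingInt Φ I a⟩ :
    endRingInt (periodIso Φ I)))

/-- `ι(a) ∈ I_𝔠` for `a ∈ 𝔠`. [cite: Kieffer2024IsogenyGraphs, §1.4.1 Def. 1.4.1, p. 43] -/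
theorem mulMatrix_mem_iotaIdeal {𝔠 : Ideal (𝓞 K)} {a : 𝓞 K} (ha : a ∈ 𝔠) :
    (⟨mulMatrix I a, mulMatrix_mem_endRingInt Φ I a⟩ : endRingInt (periodIso Φ I)) ∈ iotaIdeal Φ I 𝔠 :=
  Ideal.subset_span ⟨⟨a, ha⟩, rfl⟩

/-- **`H(End(X_𝔞)ι(𝔠)) = 𝔤(𝔠, A)`**: Kieffer's kernel subgroup of the ideal generated by `ι(𝔠)` is
Shimura's `𝔤(𝔠, A)` — both are `⋂_{a ∈ 𝔠} ker ι(a)`. [cite: Kieffer2024IsogenyGraphs, §1.4.1 Def. 1.4.1, p. 43] [cite: Shimura1998, §7.1 (before Prop. 8), p. 50] -/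
theorem kernelSubgroup_iotaIdeal (𝔠 : Ideal (𝓞 K)) :
    kernelSubgroup (periodIso Φ I) (iotaIdeal Φ I 𝔠) = idealTorsion Φ I 𝔠 := by
  rw [iotaIdeal, kernelSubgroup_span, iInf_range]
  rfl

/-- `H(I_𝔠) = 𝔤(𝔠, A)` is finite for `𝔠 ≠ 0` (it has `N(𝔠)` elements, Prop. 10).
[cite: Shimura1998, §7.2 Prop. 10, p. 53] [cite: Kieffer2024IsogenyGraphs, §1.4.1 Def. 1.4.1 ("a finite subgroup scheme"), p. 43] -/
theorem finite_kernelSubgroup_iotaIdeal {𝔠 : Ideal (𝓞 K)} (h𝔠 : 𝔠 ≠ ⊥) :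
    Finite (kernelSubgroup (periodIso Φ I) (iotaIdeal Φ I 𝔠)) := by
  rw [kernelSubgroup_iotaIdeal]
  exact finite_idealTorsion Φ h𝔠

/-- **Kieffer's `X_𝔞/H(I_𝔠)` is Shimura's `𝔠`-transform `X_{𝔠⁻¹𝔞}`**: the quotient isogeny
`φ_{I_𝔠} : X_𝔞 → X_𝔞/H(I_𝔠)` and the `𝔠`-multiplication `λ_𝔠 : X_𝔞 → X_{𝔠⁻¹𝔞}` (Prop. 8: kernel `𝔤(𝔠, A)`)
are isogenies out of `X_𝔞` with the same kernel, hence have isomorphic targets (Prop. 1.1.11).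
[cite: Kieffer2024IsogenyGraphs, §1.1.2 Prop. 1.1.11 (p. 10) and §1.4.1 Def. 1.4.1 (p. 43)] [cite: Shimura1998, §7.1 Props. 7–8, pp. 49–50] -/
theorem isIsomorphic_quotient_iotaIdeal_transformIdeal {𝔠 : Ideal (𝓞 K)} (h𝔠 : 𝔠 ≠ ⊥)
    [Finite (kernelSubgroup (periodIso Φ I) (iotaIdeal Φ I 𝔠))] :
    IsIsomorphic (quotientByPeriod (periodIso Φ I) (kernelSubgroup (periodIso Φ I) (iotaIdeal Φ I 𝔠)))
      (periodIso Φ (transformIdeal I 𝔠 h𝔠)) :=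
  (isIsogeny_quotientBy (periodIso Φ I) _).isIsomorphic_of_ker_eq
    (isIsogeny_mulMatrixOfMem Φ (one_mem_inv_mul_of_le (le_transformIdeal (I := I) h𝔠)) one_ne_zero) (by
      rw [ker_mapMatrixHom_quotientBy, kernelSubgroup_iotaIdeal, ← ker_inclusionHom_transformIdeal Φ h𝔠]
      rfl)

end IotaIdeal

/-! ## §2 `End(X_𝔞)·ι(𝔠)` is an invertible ideal, hence a kernel ideal -/

section Invertible

variable {Φ I}

/-- `1 = Σ_k γ_k c_k` with `γ_k ∈ 𝔠⁻¹`, `c_k ∈ 𝔠`, for a nonzero ideal `𝔠` of the Dedekind domain `𝓞_K`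
(`𝔠⁻¹𝔠 = 𝓞_K`). [cite: Shimura1998, §7.1 (fractional ideals of `F`, "`𝔞⁻¹`"), p. 49] -/
theorem exists_sum_mul_eq_one_of_ne_bot {𝔠 : Ideal (𝓞 K)} (h𝔠 : 𝔠 ≠ ⊥) :
    ∃ (n : ℕ) (γ : Fin n → K) (c : Fin n → 𝓞 K), (∀ k, γ k ∈ (𝔠 : FractionalIdeal (𝓞 K)⁰ K)⁻¹) ∧
      (∀ k, c k ∈ 𝔠) ∧ ∑ k, γ k * (c k : K) = 1 := by
  have h1 : (1 : K) ∈ ((𝔠 : FractionalIdeal (𝓞 K)⁰ K)⁻¹ * (𝔠 : FractionalIdeal (𝓞 K)⁰ K) :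
      FractionalIdeal (𝓞 K)⁰ K) := by
    rw [inv_mul_cancel₀ (coeIdeal_ne_zero.mpr h𝔠)]
    exact one_mem_one _
  rw [← mem_coe, coe_mul] at h1
  -- induction over the product of submodules
  refine Submodule.mul_induction_on
    (C := fun r ↦ ∃ (n : ℕ) (γ : Fin n → K) (c : Fin n → 𝓞 K),
      (∀ k, γ k ∈ (𝔠 : FractionalIdeal (𝓞 K)⁰ K)⁻¹) ∧ (∀ k, c k ∈ 𝔠) ∧ ∑ k, γ k * (c k : K) = r)
    h1 (fun m hm n hn ↦ ?_) (fun x y ⟨n₁, γ₁, c₁, hγ₁, hc₁, h₁⟩ ⟨n₂, γ₂, c₂, hγ₂, hc₂, h₂⟩ ↦ ?_)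
  · obtain ⟨c, hc, rfl⟩ := (mem_coeIdeal (𝓞 K)⁰).1 (mem_coe.1 hn)
    exact ⟨1, fun _ ↦ m, fun _ ↦ c, fun _ ↦ mem_coe.1 hm, fun _ ↦ hc, by simp⟩
  · refine ⟨n₁ + n₂, Fin.append γ₁ γ₂, Fin.append c₁ c₂, fun k ↦ ?_, fun k ↦ ?_, ?_⟩
    · refine Fin.addCases (fun i ↦ ?_) (fun j ↦ ?_) k
      · rw [Fin.append_left]; exact hγ₁ i
      · rw [Fin.append_right]; exact hγ₂ j
    · refine Fin.addCases (fun i ↦ ?_) (fun j ↦ ?_) k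
      · rw [Fin.append_left]; exact hc₁ i
      · rw [Fin.append_right]; exact hc₂ j
    · rw [Fin.sum_univ_add]
      simp only [Fin.append_left, Fin.append_right, h₁, h₂]

/-- `ι(c)_ℚ · ι_ℚ(γ) = ι(b)_ℚ` with `b = cγ ∈ 𝓞_K` whenever `c ∈ 𝔠`, `γ ∈ 𝔠⁻¹` (`𝔠𝔠⁻¹ = 𝓞_K`; `ι_ℚ` is the
rational representation `Algebra.leftMulMatrix (βᵢ)` of `K`, multiplicative).
[cite: Shimura1998, §6.1 Thm. 2 ("`ι(𝔯) = ι(F) ∩ End(A)`") and §6.2 Thm. 3, pp. 41–42] -/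
theorem exists_mulMatrix_map_eq_mul_leftMulMatrix {𝔠 : Ideal (𝓞 K)} (h𝔠 : 𝔠 ≠ ⊥) {c : 𝓞 K} (hc : c ∈ 𝔠)
    {γ : K} (hγ : γ ∈ (𝔠 : FractionalIdeal (𝓞 K)⁰ K)⁻¹) :
    ∃ b : 𝓞 K, (mulMatrix I b).map (Int.cast : ℤ → ℚ) =
      (mulMatrix I c).map (Int.cast : ℤ → ℚ) * Algebra.leftMulMatrix (basisOfFractionalIdeal K I) γ := by
  have hmem : (c : K) * γ ∈ ((𝔠 : FractionalIdeal (𝓞 K)⁰ K) * (𝔠 : FractionalIdeal (𝓞 K)⁰ K)⁻¹ :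
      FractionalIdeal (𝓞 K)⁰ K) :=
    FractionalIdeal.mul_mem_mul ((mem_coeIdeal (𝓞 K)⁰).2 ⟨c, hc, rfl⟩) hγ
  rw [mul_inv_cancel₀ (coeIdeal_ne_zero.mpr h𝔠), mem_one_iff] at hmem
  obtain ⟨b, hb⟩ := hmem
  refine ⟨b, ?_⟩
  rw [← leftMulMatrix_algebraMap_eq_map_mulMatrix, ← leftMulMatrix_algebraMap_eq_map_mulMatrix, ← map_mul]
  exact congrArg _ hb

/-- **`I_𝔠 = End(X_𝔞)·ι(𝔠)` is an invertible ideal of `End(X_𝔞)`** (Kieffer's hypothesis "Let `I` be an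
invertible ideal in `R`", for EVERY CM type `Φ`): with `1 = Σ_k γ_k c_k` (`γ_k ∈ 𝔠⁻¹`, `c_k ∈ 𝔠`) take
`x_k = ι_ℚ(γ_k) ∈ End⁰(X_𝔞)` (Thm. 3) and `σ_k = ι(c_k) ∈ I_𝔠`; `I_𝔠 x_k ⊆ End(X_𝔞)` since
`β ι(c) ι_ℚ(γ_k) = β ι(cγ_k)`, and `Σ_k x_k σ_k = ι_ℚ(Σ γ_k c_k) = 1`.
[cite: Kieffer2024IsogenyGraphs, §1.4.3 (sketch of proof of Theorem 2), p. 47] [cite: Shimura1998, §6.2 Thm. 3 and §7.1, pp. 42, 49–50] -/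
theorem isInvertibleIdeal_iotaIdeal {𝔠 : Ideal (𝓞 K)} (h𝔠 : 𝔠 ≠ ⊥) :
    IsInvertibleIdeal (periodIso Φ I) (iotaIdeal Φ I 𝔠) := by
  obtain ⟨n, γ, c, hγ, hc, hsum⟩ := exists_sum_mul_eq_one_of_ne_bot h𝔠
  refine ⟨n, fun k ↦ Algebra.leftMulMatrix (basisOfFractionalIdeal K I) (γ k),
    fun k ↦ ⟨mulMatrix I (c k), mulMatrix_mem_endRingInt Φ I (c k)⟩,
    fun k ↦ leftMulMatrix_mem_endAlgRat Φ I (γ k), fun k τ hτ ↦ ?_,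
    fun k ↦ mulMatrix_mem_iotaIdeal Φ I (hc k), ?_⟩
  · -- `I_𝔠 · ι_ℚ(γ_k) ⊆ End(X_𝔞)`, by induction over the span
    refine Submodule.span_induction (p := fun (τ : endRingInt (periodIso Φ I)) _ ↦
        ∃ r : endRingInt (periodIso Φ I),
        (r : Matrix (basisIndex I) (basisIndex I) ℤ).map (Int.cast : ℤ → ℚ) =
          (τ : Matrix (basisIndex I) (basisIndex I) ℤ).map (Int.cast : ℤ → ℚ) *
            Algebra.leftMulMatrix (basisOfFractionalIdeal K I) (γ k)) ?_ ?_ ?_ ?_ hτ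
    · rintro _ ⟨a, rfl⟩
      obtain ⟨b, hb⟩ := exists_mulMatrix_map_eq_mul_leftMulMatrix (I := I) h𝔠 a.2 (hγ k)
      exact ⟨⟨mulMatrix I b, mulMatrix_mem_endRingInt Φ I b⟩, hb⟩
    · exact ⟨0, by rw [ZeroMemClass.coe_zero, Matrix.map_zero _ Int.cast_zero, Matrix.zero_mul]⟩
    · rintro τ₁ τ₂ - - ⟨r₁, hr₁⟩ ⟨r₂, hr₂⟩
      refine ⟨r₁ + r₂, ?_⟩
      rw [Subring.coe_add, Subring.coe_add, Matrix.map_add Int.cast Int.cast_add,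
        Matrix.map_add Int.cast Int.cast_add, hr₁, hr₂, Matrix.add_mul]
    · rintro β τ - ⟨r, hr⟩
      refine ⟨β * r, ?_⟩
      rw [smul_eq_mul, Subring.coe_mul, Subring.coe_mul, map_intCast_mul_aux6, map_intCast_mul_aux6, hr,
        Matrix.mul_assoc]
  · -- `Σ_k ι_ℚ(γ_k) ι(c_k)_ℚ = ι_ℚ(Σ γ_k c_k) = ι_ℚ(1) = 1`
    calc ∑ k, Algebra.leftMulMatrix (basisOfFractionalIdeal K I) (γ k) *
          ((⟨mulMatrix I (c k), mulMatrix_mem_endRingInt Φ I (c k)⟩ : endRingInt (periodIso Φ I)) :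
            Matrix (basisIndex I) (basisIndex I) ℤ).map (Int.cast : ℤ → ℚ)
        = ∑ k, Algebra.leftMulMatrix (basisOfFractionalIdeal K I) (γ k * (c k : K)) :=
          Finset.sum_congr rfl fun k _ ↦ by
            rw [map_mul, leftMulMatrix_algebraMap_eq_map_mulMatrix]
      _ = 1 := by rw [← map_sum, hsum, map_one]

/-- **`I_𝔠` is a kernel ideal** (invertible ideals are kernel ideals, `IsInvertibleIdeal.isKernelIdeal`).
[cite: Kieffer2024IsogenyGraphs, §1.4.1 Def. 1.4.2 and §1.4.3, pp. 43, 47] -/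
theorem isKernelIdeal_iotaIdeal {𝔠 : Ideal (𝓞 K)} (h𝔠 : 𝔠 ≠ ⊥) :
    IsKernelIdeal (periodIso Φ I) (iotaIdeal Φ I 𝔠) :=
  (isInvertibleIdeal_iotaIdeal (Φ := Φ) (I := I) h𝔠).isKernelIdeal

/-- **The endomorphisms of `X_𝔞` killing `𝔤(𝔠, A)` are exactly `End(X_𝔞)·ι(𝔠)`**:
`{α ∈ End(X_𝔞) : 𝔤(𝔠, A) ⊆ ker α} = I_𝔠` (Kieffer's `I = {α : H(I) ⊂ ker(α)}` for the kernel ideal `I_𝔠`).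
[cite: Kieffer2024IsogenyGraphs, §1.4.1 Def. 1.4.2, p. 43] [cite: Shimura1998, §7.1 Prop. 8, p. 50] -/
theorem idealOfSubgroup_idealTorsion {𝔠 : Ideal (𝓞 K)} (h𝔠 : 𝔠 ≠ ⊥) :
    idealOfSubgroup (periodIso Φ I) (idealTorsion Φ I 𝔠) = iotaIdeal Φ I 𝔠 := by
  rw [← kernelSubgroup_iotaIdeal]
  exact isKernelIdeal_iotaIdeal h𝔠

/-- **Kieffer's trivial-class criterion for `𝔤(𝔠, A)`**: `X_𝔞/𝔤(𝔠, A) ≅ X_𝔞` as complex tori iff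
`End(X_𝔞)·ι(𝔠) = End(X_𝔞)α` for an isogeny `α ∈ End(X_𝔞)` ("`A/H(I) ≃ A` if and only if `I` lies in the
trivial class"). [cite: Kieffer2024IsogenyGraphs, §1.4.3 (sketch of proof of Theorem 2), p. 47] -/
theorem isIsomorphic_quotient_iotaIdeal_self_iff {𝔠 : Ideal (𝓞 K)} (h𝔠 : 𝔠 ≠ ⊥)
    [Finite (kernelSubgroup (periodIso Φ I) (iotaIdeal Φ I 𝔠))] :
    IsIsomorphic (quotientByPeriod (periodIso Φ I) (kernelSubgroup (periodIso Φ I) (iotaIdeal Φ I 𝔠)))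
        (periodIso Φ I) ↔
      ∃ α : endRingInt (periodIso Φ I), (α : Matrix (basisIndex I) (basisIndex I) ℤ).det ≠ 0 ∧
        iotaIdeal Φ I 𝔠 = Ideal.span {α} :=
  (isInvertibleIdeal_iotaIdeal (Φ := Φ) (I := I) h𝔠).isIsomorphic_quotient_self_iff

/-- Hence: **the `𝔠`-transform `X_{𝔠⁻¹𝔞}` is isomorphic to `X_𝔞` (as a complex torus) iff
`End(X_𝔞)·ι(𝔠)` is principal, generated by an isogeny.** [cite: Kieffer2024IsogenyGraphs, §1.4.3 (sketch of proof of Theorem 2), p. 47] [cite: Shimura1998, §7.3 (ideal classes and transforms), p. 57] -/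
theorem isIsomorphic_transformIdeal_iff {𝔠 : Ideal (𝓞 K)} (h𝔠 : 𝔠 ≠ ⊥) :
    IsIsomorphic (periodIso Φ (transformIdeal I 𝔠 h𝔠)) (periodIso Φ I) ↔
      ∃ α : endRingInt (periodIso Φ I), (α : Matrix (basisIndex I) (basisIndex I) ℤ).det ≠ 0 ∧
        iotaIdeal Φ I 𝔠 = Ideal.span {α} := by
  haveI := finite_kernelSubgroup_iotaIdeal Φ I h𝔠
  rw [← isIsomorphic_quotient_iotaIdeal_self_iff h𝔠]
  have h := isIsomorphic_quotient_iotaIdeal_transformIdeal Φ I h𝔠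
  exact ⟨fun h' ↦ h.trans h', fun h' ↦ h.symm.trans h'⟩

end Invertible

/-! ## §3 Primitive CM types: `End(X_𝔞) = ι(𝓞_K)` and Shimura's criterion -/

section Primitive

variable {Φ I}

/-- For a primitive CM type, `I_𝔠` is the image `ι(𝔠)·` of `𝔠` under `𝓞_K ≅ End(X_𝔞)`
(`endRingEquivOfPrimitive`). [cite: Shimura1998, §14.1 Prop. 1 and §6.1 Thm. 2 ("`ι(𝔯) = ι(F) ∩ End(A)`"), pp. 41, 101] -/
theorem iotaIdeal_eq_map_of_primitive
    (hprim : ∀ s t : K →+* ℂ,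
      (∀ τ : ℂ ≃+* ℂ, ((τ : ℂ →+* ℂ).comp s ∈ Φ.1 ↔ (τ : ℂ →+* ℂ).comp t ∈ Φ.1)) → s = t)
    (𝔠 : Ideal (𝓞 K)) :
    iotaIdeal Φ I 𝔠 =
      Ideal.map (endRingEquivOfPrimitive I hprim (Φ := Φ) : 𝓞 K →+* endRingInt (periodIso Φ I)) 𝔠 := by
  rw [iotaIdeal, Ideal.map]
  congr 1
  ext σ
  constructor
  · rintro ⟨a, rfl⟩
    exact ⟨a, a.2, Subtype.ext (coe_endRingEquivOfPrimitive_apply (Φ := Φ) (I := I) hprim a).symm⟩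
  · rintro ⟨a, ha, rfl⟩
    exact ⟨⟨a, ha⟩, Subtype.ext (coe_endRingEquivOfPrimitive_apply (Φ := Φ) (I := I) hprim a)⟩

/-- **Shimura §7.3 from Kieffer's criterion, for a primitive CM type: the `𝔠`-transform `X_{𝔠⁻¹𝔞}` is
isomorphic to `X_𝔞` as a complex torus iff `𝔠` is principal** ("`(A_c, ι_c)` and `(A_d, ι_d)` are
isomorphic if and only if `c = d`", with `d` the trivial class; for primitive types every isomorphism is
`ι`-equivariant, §14.1 Prop. 1). [cite: Shimura1998, §7.3, p. 57; §14.1 Prop. 1, p. 101] [cite: Kieffer2024IsogenyGraphs, §1.4.3 (sketch of proof of Theorem 2: "`A/H(I) ≃ A` if and only if `I` lies in the trivial class"), p. 47] -/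
theorem isIsomorphic_transformIdeal_iff_isPrincipal_of_primitive
    (hprim : ∀ s t : K →+* ℂ,
      (∀ τ : ℂ ≃+* ℂ, ((τ : ℂ →+* ℂ).comp s ∈ Φ.1 ↔ (τ : ℂ →+* ℂ).comp t ∈ Φ.1)) → s = t)
    {𝔠 : Ideal (𝓞 K)} (h𝔠 : 𝔠 ≠ ⊥) :
    IsIsomorphic (periodIso Φ (transformIdeal I 𝔠 h𝔠)) (periodIso Φ I) ↔ 𝔠.IsPrincipal := by
  rw [isIsomorphic_transformIdeal_iff h𝔠, iotaIdeal_eq_map_of_primitive hprim]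
  set e := endRingEquivOfPrimitive I hprim (Φ := Φ) with he
  constructor
  · rintro ⟨α, -, hα⟩
    -- `𝔠 = e⁻¹(End(X_𝔞) α) = 𝓞_K · e⁻¹(α)`
    have h : 𝔠 = Ideal.span {e.symm α} := by
      have h1 := congrArg (Ideal.map (e.symm : endRingInt (periodIso Φ I) →+* 𝓞 K)) hα
      rwa [Ideal.map_of_equiv, Ideal.map_span, Set.image_singleton] at h1
    exact ⟨⟨e.symm α, by rw [h, Ideal.submodule_span_eq]⟩⟩
  · rintro ⟨a, ha⟩
    have ha' : 𝔠 = Ideal.span {a} := by rw [ha, Ideal.submodule_span_eq]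
    have ha0 : a ≠ 0 := by
      rintro rfl
      apply h𝔠
      rw [ha', Ideal.span_singleton_eq_bot]
    refine ⟨e a, ?_, by rw [ha', Ideal.map_span, Set.image_singleton]; rfl⟩
    rw [he, coe_endRingEquivOfPrimitive_apply, det_mulMatrix_eq_norm]
    exact (Algebra.norm_ne_zero_iff.2 ha0)

end Primitive

/-! ## §4 Kieffer's Theorem 1.4.9 for the principal CM tori of a primitive type -/

section Thm149

/-- **`deg φ_{I_𝔠} = #H(End(X_𝔞)ι(𝔠)) = N(𝔠)`** for every CM type ("the degree of `φ_I` equals the reduced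
norm of `I`" — here `#𝔤(𝔠, A) = N(𝔠)`, Shimura's Prop. 10 via `natCard_idealTorsion`).
[cite: Kieffer2024IsogenyGraphs, §1.4.2 Thm. 1.4.9, p. 46] [cite: Shimura1998, §7.2 Prop. 10, p. 53] -/
theorem natCard_kernelSubgroup_iotaIdeal {𝔠 : Ideal (𝓞 K)} (h𝔠 : 𝔠 ≠ ⊥) :
    Nat.card (kernelSubgroup (periodIso Φ I) (iotaIdeal Φ I 𝔠)) = Ideal.absNorm 𝔠 := by
  rw [kernelSubgroup_iotaIdeal]
  exact natCard_idealTorsion Φ h𝔠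

/-- `I_{(0)} = 0`. [cite: Kieffer2024IsogenyGraphs, §1.4.1 Def. 1.4.1, p. 43] -/
@[simp] theorem iotaIdeal_bot : iotaIdeal Φ I (⊥ : Ideal (𝓞 K)) = ⊥ := by
  refine Ideal.span_eq_bot.2 ?_
  rintro _ ⟨a, rfl⟩
  have ha : (a : 𝓞 K) = 0 := (Submodule.mem_bot (𝓞 K)).1 a.2
  refine Subtype.ext ?_
  show mulMatrix I (a : 𝓞 K) = ((0 : endRingInt (periodIso Φ I)) : Matrix (basisIndex I) (basisIndex I) ℤ)
  rw [ha, ZeroMemClass.coe_zero, ← mulMatrixHom_apply, map_zero]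

/-- The zero ideal of `End(X)` is a kernel ideal (`H(0) = X` and only `0` kills `X`: the rational
representation is faithful). [cite: Kieffer2024IsogenyGraphs, §1.4.1 Def. 1.4.2, p. 43] -/
theorem isKernelIdeal_bot : IsKernelIdeal (periodIso Φ I) (⊥ : Ideal (endRingInt (periodIso Φ I))) := by
  refine (isKernelIdeal_iff_le _).2 fun α hα ↦ ?_
  rw [kernelSubgroup_bot, mem_idealOfSubgroup_iff] at hα
  have h0 : mapMatrix (periodIso Φ I) (periodIso Φ I) (α : Matrix (basisIndex I) (basisIndex I) ℤ) =
      mapMatrix (periodIso Φ I) (periodIso Φ I) (0 : Matrix (basisIndex I) (basisIndex I) ℤ) := by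
    funext t
    rw [mapMatrix_zero_matrix]
    exact hα (AddSubgroup.mem_top t)
  have hα0 : α = 0 := Subtype.ext (mapMatrix_injective h0)
  rw [hα0]
  exact Submodule.zero_mem _

variable {Φ I}

/-- For a primitive CM type every ideal of `End(X_𝔞) = ι(𝓞_K)` is an `I_𝔠` (`𝔠 = ι⁻¹(J)`).
[cite: Shimura1998, §14.1 Prop. 1 and §6.1 Thm. 2, pp. 41, 101] -/
theorem eq_iotaIdeal_comap_of_primitive
    (hprim : ∀ s t : K →+* ℂ,
      (∀ τ : ℂ ≃+* ℂ, ((τ : ℂ →+* ℂ).comp s ∈ Φ.1 ↔ (τ : ℂ →+* ℂ).comp t ∈ Φ.1)) → s = t)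
    (J : Ideal (endRingInt (periodIso Φ I))) :
    J = iotaIdeal Φ I
      (J.comap (endRingEquivOfPrimitive I hprim (Φ := Φ) : 𝓞 K →+* endRingInt (periodIso Φ I))) := by
  rw [iotaIdeal_eq_map_of_primitive hprim,
    Ideal.map_comap_of_surjective
      (endRingEquivOfPrimitive I hprim (Φ := Φ) : 𝓞 K →+* endRingInt (periodIso Φ I))
      (endRingEquivOfPrimitive I hprim (Φ := Φ)).surjective]

/-- **THEOREM 1.4.9 (first clause) for the principal CM tori of a primitive type: "assume that `End(A)`
is a maximal order. Then every ideal `I` of `End(A)` is a kernel ideal"** — `End(X_𝔞) = ι(𝓞_K)` is the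
maximal order and every non-zero ideal is `I_𝔠`, invertible. [cite: Kieffer2024IsogenyGraphs, §1.4.2 Thm. 1.4.9, p. 46] [cite: Shimura1998, §14.1 Prop. 1, p. 101] -/
theorem isKernelIdeal_of_primitive
    (hprim : ∀ s t : K →+* ℂ,
      (∀ τ : ℂ ≃+* ℂ, ((τ : ℂ →+* ℂ).comp s ∈ Φ.1 ↔ (τ : ℂ →+* ℂ).comp t ∈ Φ.1)) → s = t)
    (J : Ideal (endRingInt (periodIso Φ I))) : IsKernelIdeal (periodIso Φ I) J := by
  by_cases h𝔠 : J.comap (endRingEquivOfPrimitive I hprim (Φ := Φ) : 𝓞 K →+* endRingInt (periodIso Φ I)) = ⊥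
  · have hJ : J = ⊥ := by rw [eq_iotaIdeal_comap_of_primitive hprim J, h𝔠, iotaIdeal_bot]
    rw [hJ]
    exact isKernelIdeal_bot Φ I
  · rw [eq_iotaIdeal_comap_of_primitive hprim J]
    exact isKernelIdeal_iotaIdeal h𝔠

/-- For a primitive CM type `End⁰(X_𝔞) = ι(K)` is commutative (in the ambient-matrix form used by
`IsInvertibleIdeal.rightOrder_eq`). [cite: Shimura1998, §8.2 Prop. 26 and §5.1 Prop. 6] -/
theorem endAlgRat_comm_of_primitive [IsCMField K]
    (hprim : ∀ s t : K →+* ℂ,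
      (∀ τ : ℂ ≃+* ℂ, ((τ : ℂ →+* ℂ).comp s ∈ Φ.1 ↔ (τ : ℂ →+* ℂ).comp t ∈ Φ.1)) → s = t) :
    ∀ M ∈ endAlgRat (periodIso Φ I), ∀ N ∈ endAlgRat (periodIso Φ I), M * N = N * M :=
  fun M hM N hN ↦ congrArg Subtype.val ((primitive_iff_endAlgRat_comm Φ I).1 hprim ⟨M, hM⟩ ⟨N, hN⟩)

/-- **THEOREM 1.4.9 (last clause) for the principal CM tori of a primitive type: "the endomorphism ring of
`A/H(I)` is also maximal"** — `End(X_𝔞/H(I_𝔠)) ≅ End(X_𝔞) ≅ 𝓞_K` (Prop. 1.4.7 for the invertible ideal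
`I_𝔠` of the commutative `End⁰(X_𝔞) = ι(K)`, `IsInvertibleIdeal.quotientEndEquiv`).  A DEFINITION with a body.
[cite: Kieffer2024IsogenyGraphs, §1.4.2 Thm. 1.4.9 and §1.4.3 ("the endomorphism ring of `A/H(I)` is still `R`"), pp. 46–47] [cite: Shimura1998, §14.1 Prop. 1, p. 101] -/
def quotientEndEquivRingOfIntegersOfPrimitive [IsCMField K]
    (hprim : ∀ s t : K →+* ℂ,
      (∀ τ : ℂ ≃+* ℂ, ((τ : ℂ →+* ℂ).comp s ∈ Φ.1 ↔ (τ : ℂ →+* ℂ).comp t ∈ Φ.1)) → s = t)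
    {𝔠 : Ideal (𝓞 K)} (h𝔠 : 𝔠 ≠ ⊥) [Finite (kernelSubgroup (periodIso Φ I) (iotaIdeal Φ I 𝔠))] :
    endRingInt (quotientByPeriod (periodIso Φ I) (kernelSubgroup (periodIso Φ I) (iotaIdeal Φ I 𝔠))) ≃+* 𝓞 K :=
  ((isInvertibleIdeal_iotaIdeal (Φ := Φ) (I := I) h𝔠).quotientEndEquiv (endAlgRat_comm_of_primitive hprim)).trans
    (endRingEquivOfPrimitive I hprim (Φ := Φ)).symm

/-- The identification is `η` followed by `ι⁻¹`: `ι(quotientEndEquiv… γ)_ℚ = η(γ)`.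
[cite: Kieffer2024IsogenyGraphs, §1.4.2 Thm. 1.4.9 and §1.4.1 Prop. 1.4.7, pp. 45–46] -/
theorem map_mulMatrix_quotientEndEquivRingOfIntegersOfPrimitive [IsCMField K]
    (hprim : ∀ s t : K →+* ℂ,
      (∀ τ : ℂ ≃+* ℂ, ((τ : ℂ →+* ℂ).comp s ∈ Φ.1 ↔ (τ : ℂ →+* ℂ).comp t ∈ Φ.1)) → s = t)
    {𝔠 : Ideal (𝓞 K)} (h𝔠 : 𝔠 ≠ ⊥) [Finite (kernelSubgroup (periodIso Φ I) (iotaIdeal Φ I 𝔠))]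
    (γ : endRingInt (quotientByPeriod (periodIso Φ I) (kernelSubgroup (periodIso Φ I) (iotaIdeal Φ I 𝔠)))) :
    (mulMatrix I (quotientEndEquivRingOfIntegersOfPrimitive hprim h𝔠 γ)).map (Int.cast : ℤ → ℚ) =
      quotientEndHom (periodIso Φ I) (kernelSubgroup (periodIso Φ I) (iotaIdeal Φ I 𝔠)) γ := by
  rw [← (isInvertibleIdeal_iotaIdeal (Φ := Φ) (I := I) h𝔠).coe_quotientEndEquiv (endAlgRat_comm_of_primitive hprim) γ,
    quotientEndEquivRingOfIntegersOfPrimitive, RingEquiv.trans_apply, ← coe_endRingEquivOfPrimitive_apply hprim,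
    RingEquiv.apply_symm_apply]

end Thm149

end CMTypeLattice

end Literature.NumberTheory.ComplexMultiplication
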